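import Summits.BirchSwinnertonDyer.BirchSwinnertonDyer.Theorems.RamifiedHeegnerPairWAllExclAddGssAtThreeColumnAssembly
import Summits.BirchSwinnertonDyer.BirchSwinnertonDyer.Theorems.RamifiedHeegnerPairGss2LowerAtThreeRankZeroCertificateRoadByName
import Summits.BirchSwinnertonDyer.BirchSwinnertonDyer.Theorems.RamifiedHeegnerPairLeafRankOneUpperAtThreeTwistUnit
import HarnessLib

/-!
# Route `RamifiedHeegnerPair` (leaf `WAllExclAddGssAtThree`, W-ALL row 2·3@3) — the COLUMN ASSEMBLY v2: with the rank-one TWIST-UNIT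
# statement TU₁ (rhp-p2 g7, p630223) as the S₋ input, the residual member L₀ 26023 is DERIVED (L₀ ⟸ PUB ∧ STRUCT ∧ A₀ ∧ U₁, p631233),
# so the Gss2 leaf closes from PRINT ∧ the pair statements on all frames (T1⁻: A 27200, A₃ₙₙ, A₀; T1⁺: S2 27492, Σ★″ 27493)
# ∧ U₀ on the `3Nn` rank-zero rows ∧ TU₁ — NO Kato-⊇, NO member taken as a separation hypothesis

HONEST FRAMING. Theorems only; helper file (`--supports stmt-BirchSwinnertonDyer-26021 --as helper`); nothing is booked, no item is closed,
BSD is not proved for any curve; every research hypothesis below is OPEN (A, A₃ₙₙ, A₀ = T1⁻ at an additive 3; S2, Σ★″ = T1⁺ readings;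
U₀|3Nn inside `EulerSystemBigImageBarrier`; TU₁ = an arithmetic-statistics existence statement with SURPLUS over the leaf — «some Heegner
field whose rank-0 twist has 3-unit #Ш_an», no print at an additive 3: Ono–Skinner 1998 / Prasanna 2010 / Burungale–Hida–Tian exclude
p ∣ N). Lead prover bsd-line-rhp-p1 g6, 2026-08-28. Sequel of `…WAllExclAddGssAtThreeColumnAssembly.lean` (p631681: v1 takes L₀ 26023 as
the S₋ input) and memo COUPLING-CALCULUS-rhp-p1-g6.md (v2).

WHY. v1's S₋ input was the residual member L₀ itself (Kato-⊇ index-exact, announced only). rhp-p2 g7's twist-unit road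
(`RamifiedPairUpperBound.leafRankOneUpperAtThree_of_pubManin_of_divisibilityReading_of_sigmaStar_of_twistUnit`: U₁ ⟸ PUB⁺ ∧ S2 ∧ Σ★″ ∧ TU₁,
L₀-FREE) and this lead's L₀ door by name (`RamifiedPairLowerBound.gss2LowerAtThreeRankZero_of_structIrr_of_certificatesZero_of_leafRankOneUpper`:
L₀ ⟸ PUB ∧ STRUCT ∧ A₀ ∧ U₁, rationality discharged from A₀'s datum) compose WITHOUT a circle: TU₁ ⟹ U₁ ⟹ L₀. Asymmetry used: a unit
`#Ш_an` of a twist trivialises a LOWER half, so the upper members can be freed from their partners' lower halves by twist-unit statements,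
and then the lower members follow from T1⁻ through the joint-lower calculus.

* `wAllExclAddGssAtThree_of_print_of_pairStatements_of_upper3Nn_of_twistUnit` — leaf ⟸ GZK ∧ PUB 27199 ∧ PUB⁺ 27491 ∧ MN (print) ∧
  A 27200 ∧ A₃ₙₙ ∧ A₀ (T1⁻) ∧ S2 27492 ∧ Σ★″ 27493 (T1⁺) ∧ U₀|3Nn (S₊ off the tower) ∧ TU₁.
The mirror replacement of U₀|3Nn by a rank-ZERO twist-unit statement TU₀ (rhp-p2's U₀ twist-unit road; pen option (b), pre-staged
2026-08-28T11:56:31Z) would leave: print ∧ {T1⁻, T1⁺ on all frames} ∧ TU₀|3Nn ∧ TU₁ — appended here when that road lands.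

References: [cite: MatarNekovar2019, Thm. 0.7 (p. 456) and §0.11 (p. 457)] [cite: McCallumLMS1991, §5 Cor. 5.6 (p. 310)]
[cite: Kato2004Asterisque, Thm. 14.5 (3) (p. 236), Prop. 14.16 (2) (p. 244)] [cite: Jetchev2008, Thm. 1.4, Conj. 1.3]
[cite: OnoSkinner1998, Thm. 1 / Cor. 2] [cite: Miller2011LMS, Def. 1.1] [cite: GrossZagier1986, Thm. I.(6.3)] [cite: Kolyvagin1990, Thm. A].
-/

-- D-0017: single-problem summit, so `Summit.BirchSwinnertonDyer.BirchSwinnertonDyer.…` repeats a namespace BY DESIGN.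
set_option linter.dupNamespace false
set_option autoImplicit false

noncomputable section

open scoped Classical NumberField

open WeierstrassCurve Literature.NumberTheory.EllipticCurves
  Literature.NumberTheory.EllipticCurves.Rank1Residual
  Literature.NumberTheory.EllipticCurves.Rank1Residual.Typed
  Summit.BirchSwinnertonDyer.Rank1Residual
  Summit.BirchSwinnertonDyer.Rank1Residual.Additive
  Summit.BirchSwinnertonDyer.BirchSwinnertonDyer.Theorems
  Summit.BirchSwinnertonDyer.BirchSwinnertonDyer.Theses.RamifiedHeegnerPair

namespace Summit.BirchSwinnertonDyer.BirchSwinnertonDyer.Theorems.RamifiedPairLowerBound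

/-- **THE Gss2 COLUMN MODULO THE PAIR STATEMENTS, v2 (S₋ := TU₁; L₀ DERIVED).** `WAllExclAddGssAtThree` from: PRINT — GZK, PUB 27199, PUB⁺
27491, the Matar–Nekovář structure fact; T1⁻ — A 27200 (tower rows), A₃ₙₙ (`3Nn` rows), A₀ (rank-zero rows, at frames whose twist has
analytic rank one); the T1⁺ readings — S2 27492, Σ★″ 27493; S₊ off the tower — U₀ on the `3Nn` rank-zero rows; S₋ — TU₁ (for every
non-CM rank-one leaf curve, `SchneiderFree.Upper.TwistUnitFieldAt W 3`). Chain: TU₁ ⟹ U₁ (rhp-p2 p630223); U₁ ∧ A₀ ⟹ L₀ (p631233 §3); v5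
composition ⟹ L₁ (p631681 §1); Kato A161″ ∧ U₀|3Nn ⟹ U₀ (p630156); `closes`. Books nothing; states what the column costs once S₋ is paid by
the twist-unit statement instead of a member. [cite: Miller2011LMS, Def. 1.1] [cite: MatarNekovar2019, Thm. 0.7 (p. 456) and §0.11 (p. 457)]
[cite: Kato2004Asterisque, Thm. 14.5 (3) (p. 236)] [cite: Jetchev2008, Thm. 1.4] [cite: OnoSkinner1998, Thm. 1] -/
theorem wAllExclAddGssAtThree_of_print_of_pairStatements_of_upper3Nn_of_twistUnit
    (hP : PublishedInputGZK) (hpub : Gss2LowerPrintedInputsAtThree) (hpubU : LeafRankOnePrintedInputsAtThree)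
    (hMN : MatarNekovar2019.thm07_pow_dvd_card_sha_primary_of_certificate_of_irreducible)
    (hC : Gss2RankOneMcCallumCertificateAtThreeTower)
    (hC3 : ∀ (W : WeierstrassCurve ℚ) [W.IsElliptic] [W.IsGloballyMinimal], ¬ W.HasCM →
      Literature.NumberTheory.EllipticCurves.Rank1Residual.Addv W 3 → Summit.BirchSwinnertonDyer.Rank1Residual.Additive.SubGss W 3 →
      W.analyticRank = 1 → ¬ W.HasSurjectiveModNGaloisRep 3 →
      ∃ (N : ℕ) (_ : NeZero N) (K : Type) (_ : Field K) (_ : NumberField K)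
        (Dt : Literature.NumberTheory.EllipticCurves.ModularForms.ModularParametrizationData W N)
        (H : Literature.NumberTheory.EllipticCurves.HeegnerDatum N (NumberField.discr K)) (ι : K →+* ℂ)
        (P : (W.baseChange K).toAffine.Point) (Wd : WeierstrassCurve ℚ) (_ : Wd.IsElliptic) (_ : Wd.IsGloballyMinimal)
        (Cd : WeierstrassCurve.VariableChange ℚ) (M : ℕ),
        W.conductorNorm ℤ = N ∧ Literature.NumberTheory.EllipticCurves.IsImaginaryQuadratic K ∧ Odd (NumberField.discr K) ∧
        Literature.NumberTheory.EllipticCurves.SatisfiesHeegnerHypothesis N K ∧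
        (W.quadraticTwist (NumberField.discr K : ℚ)).entireLFunction 1 ≠ 0 ∧
        WeierstrassCurve.Affine.Point.map ι.toRatAlgHom P = Literature.NumberTheory.EllipticCurves.ModularForms.heegnerPointComplex Dt H ∧
        Cd • W.quadraticTwist (NumberField.discr K : ℚ) = Wd ∧
        (2 * M : ℤ) ≤ padicValNat 3 W.tamagawaProduct + padicValNat 3 Wd.tamagawaProduct + 2 * padicValRat 3 (Dt.c : ℚ) ∧
        Summit.BirchSwinnertonDyer.Rank1Residual.X11b.Three.Koly.CertificateAt Dt H.β ι 3 M)
    (hC0 : ∀ (W : WeierstrassCurve ℚ) [W.IsElliptic] [W.IsGloballyMinimal], ¬ W.HasCM →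
      Literature.NumberTheory.EllipticCurves.Rank1Residual.Addv W 3 →
      Summit.BirchSwinnertonDyer.Rank1Residual.Additive.SubGss W 3 → W.analyticRank = 0 →
      ∃ (N : ℕ) (_ : NeZero N) (K : Type) (_ : Field K) (_ : NumberField K)
        (Dt : Literature.NumberTheory.EllipticCurves.ModularForms.ModularParametrizationData W N)
        (H : Literature.NumberTheory.EllipticCurves.HeegnerDatum N (NumberField.discr K)) (ι : K →+* ℂ)
        (P : (W.baseChange K).toAffine.Point) (Wd : WeierstrassCurve ℚ) (_ : Wd.IsElliptic) (_ : Wd.IsGloballyMinimal)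
        (Cd : WeierstrassCurve.VariableChange ℚ) (M : ℕ),
        W.conductorNorm ℤ = N ∧ Literature.NumberTheory.EllipticCurves.IsImaginaryQuadratic K ∧ Odd (NumberField.discr K) ∧
        Literature.NumberTheory.EllipticCurves.SatisfiesHeegnerHypothesis N K ∧
        (W.quadraticTwist (NumberField.discr K : ℚ)).analyticRank = 1 ∧
        WeierstrassCurve.Affine.Point.map ι.toRatAlgHom P =
          Literature.NumberTheory.EllipticCurves.ModularForms.heegnerPointComplex Dt H ∧
        Cd • W.quadraticTwist (NumberField.discr K : ℚ) = Wd ∧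
        (2 * M : ℤ) ≤ padicValNat 3 W.tamagawaProduct + padicValNat 3 Wd.tamagawaProduct + 2 * padicValRat 3 (Dt.c : ℚ) ∧
        Summit.BirchSwinnertonDyer.Rank1Residual.X11b.Three.Koly.CertificateAt Dt H.β ι 3 M)
    (hS2 : JetchevDivisibilityReadingS2) (hSig : LeafSigmaStarDivisibilityAtThreeOptimalOffRows)
    (hU03 : ∀ (W : WeierstrassCurve ℚ) [W.IsElliptic] [W.IsGloballyMinimal], ¬ W.HasCM →
      Literature.NumberTheory.EllipticCurves.Rank1Residual.Addv W 3 → Summit.BirchSwinnertonDyer.Rank1Residual.Additive.SubGss W 3 →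
      W.analyticRank = 0 → ¬ W.HasSurjectiveModNGaloisRep 3 →
      Literature.NumberTheory.EllipticCurves.Rank1Residual.Typed.MissingUpperBoundAt W 3)
    (hTU : ∀ (W : WeierstrassCurve ℚ) [W.IsElliptic] [W.IsGloballyMinimal], ¬ W.HasCM →
      Literature.NumberTheory.EllipticCurves.Rank1Residual.Addv W 3 →
      Summit.BirchSwinnertonDyer.Rank1Residual.Additive.SubGss W 3 → W.analyticRank = 1 →
      SchneiderFree.Upper.TwistUnitFieldAt W 3) :
    Summit.BirchSwinnertonDyer.WAllExclAddGssAtThree := by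
  obtain ⟨⟨hGZ, hKo, -, hGZK, hmod, -, -, -, -, -⟩, hKatoT⟩ := id hpub
  have hL1 : Gss2LowerAtThreeRankOne :=
    gss2LowerAtThreeRankOne_of_pub_of_certificatesTower_of_structIrr_of_certificates3Nn_of_upper3Nn hpub hC hMN hC3 hU03
  have hU1 : LeafRankOneUpperAtThree :=
    RamifiedPairUpperBound.leafRankOneUpperAtThree_of_pubManin_of_divisibilityReading_of_sigmaStar_of_twistUnit hpubU hS2 hSig hTU
  have hL0 : Gss2LowerAtThreeRankZero :=
    gss2LowerAtThreeRankZero_of_structIrr_of_certificatesZero_of_leafRankOneUpper hGZ hKo hGZK hmod hMN hC0 hU1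
  have hU0 : LeafRankZeroUpperAtThree :=
    RamifiedPairUpperBound.leafRankZeroUpperAtThree_of_katoTam_of_nonSurjThree hKatoT hGZK hmod hU03
  exact closes hP hL1 hU1 hL0 hU0

end Summit.BirchSwinnertonDyer.BirchSwinnertonDyer.Theorems.RamifiedPairLowerBound

end
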